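import Summits.QuantumFields.YangMills.Theorems.LangevinControlUVOSLegsFromFemtoAndGapDefs
import Summits.QuantumFields.YangMills.Theorems.ForcedResponseSkewnessRunningCouplingCeilingDefs
import HarnessLib

/-!
# Route `ForcedResponseSkewness`, crux `ResponseLocalisation` (stmt-QuantumFields-23615): vocabulary of line `birth`

Route-posited objects (D-0016 `<Route><Crux>Defs` file) shared by the registered stubs of the skeleton
`Cruxes/ResponseLocalisation/Lines/birth.lean` (ideator ym-idea-3 g2's BC3 skeleton, registered by the lead
`ym-line-frs-p1`): VERBATIM the skeleton's declarations (same namespace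
`Summit.QuantumFields.YangMills.Cruxes.ResponseLocalisation.Birth`, so the registered signatures
`stub_split : SplitSig`, `stub_contact : ContactSig`, `stub_far : FarSig`, `stub_shell : ShellSig` are unchanged and stub files
import this module instead of re-declaring).  NOTHING here is asserted: `respM` is bookkeeping over tree objects (`torusK3`), and
every `def … : Prop` is a line statement some registered stub proves (none is a literature fact, none restates the crux).

* `respM` — the response profile `M_{β,L,s}(x) = Σ_{y,z ∈ box L} θv(s y) v(s z) torusK3_{β,L}(x,y,z)` of clause (i)'s object
  (`Q3(f,θv,v) = Σ_x f(s x) M(x)`; by the tree's sum rule `hasDerivAt_torusCov_dens_coupling`, `∂_β Q2(θv,v) = Σ_x M(x)`).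
* `SplitSig` (exact bookkeeping, provable now), `ShellSig` (smooth Urysohn, provable now), `FarSig` (far-field ceiling),
  `ContactSig` (contact ceiling — the hardest stub; LEAD'S CAVEAT: as typed it bounds the `|respM|`-mass over the whole
  δ-neighbourhood of `K = tsupport v ∪ tsupport θv`, whose interior carries an `O(ḡ²(ρξ))` share of the response for a `v` of
  support radius `ρ`; like the crux itself (`∀ v`, absolute `η`) it is believed false whenever its floor hypothesis is met and is
  formally undecidable today — see `Cruxes/ResponseLocalisation/Lines/birth.md` §REPAIRS; not to be staffed before the planner rules).

No summit is proved by any of this (leaf R2a `BalabanLadder.NT`, conditional line; the YM mass gap is NOT proved).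
Refs: route file `Theses/ForcedResponseSkewness.lean`; line card `Cruxes/ResponseLocalisation/Lines/birth.md`;
Rothe, Lattice Gauge Theories (2005) p.138 (action sum rule).
-/

set_option autoImplicit false

noncomputable section

namespace Summit.QuantumFields.YangMills.Cruxes.ResponseLocalisation.Birth

open MeasureTheory Filter Topology
open Literature.MathematicalPhysics.QuantumFieldTheory Literature.MathematicalPhysics.QuantumLattice
open Literature.Probability.LatticeModels
open Summit.QuantumFields.YangMills.Cruxes.OSLegsFromFemtoAndGap.DlrCollarTransfer

section Profile

variable (G : Type) [Group G] [TopologicalSpace G] [IsTopologicalGroup G] [CompactSpace G]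
  [MeasurableSpace G] [BorelSpace G] (r : LatticeRep G)

/-- The RESPONSE PROFILE of clause (i)'s object: `M_{β,L,s}(x) := Σ_{y,z ∈ box L} θv(s·y) v(s·z) torusK3_{β,L}(x,y,z)`
(so that `Q3(f,θv,v) = Σ_x f(s·x) M(x)` and, by the sum rule, `∂_β Q2(θv,v) = Σ_x M(x)`). -/
def respM (β : ℝ) (L : ℕ) (s : ℝ) (v : SchwartzMap (EuclideanSpace ℝ (Fin 4)) ℝ)
    (x : Fin 4 → ℤ) : ℝ :=
  ∑ y ∈ box 4 L, ∑ z ∈ box 4 L,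
    (thetaTest 4 v) (s • siteToE y) * v (s • siteToE z) * torusK3 G r β L x y z

end Profile

/-- **Statement of `stub_split`** (exact bookkeeping, size M, provable now): for every compact simple `G` (Borel σ-algebra),
`r`, `β`, odd torus `2L+1`, spacing `s` and Schwartz `v, f`,
`∂_c Q2_{c,L,s}(θv, v)|_{c=β} − Q3_{β,L,s}(f, θv, v) = Σ_{x ∈ box L} (1 − f(s x)) · respM_{β,L,s}(x)` — the tree's third-order
sum rule `CouplingSumRule.hasDerivAt_torusCov_dens_coupling` (`∂_β Cov_T(A_x,A_y) = Σ_z torusK3(x,y,z)`) smeared with `θv ⊗ v`,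
plus the cyclic symmetry of `torusK3`. -/
def SplitSig : Prop :=
  ∀ (G : Type) [Group G] [TopologicalSpace G] [IsTopologicalGroup G] [CompactSpace G],
    IsCompactSimpleLieGroup G →
    letI : MeasurableSpace G := borel G
    haveI : BorelSpace G := ⟨rfl⟩
    ∀ (r : LatticeRep G) (β : ℝ) (L : ℕ) (s : ℝ) (v f : SchwartzMap (EuclideanSpace ℝ (Fin 4)) ℝ),
      deriv (fun c : ℝ => Q2 G r c L s (thetaTest 4 v) v) β - Q3 G r β L s f (thetaTest 4 v) v =
        ∑ x ∈ box 4 L, (1 - f (s • siteToE x)) * respM G r β L s v x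

/-- **Statement of `stub_contact`** (the CONTACT CEILING — hardest stub, XL; SEE THE MODULE CAVEAT): for a unit map and a
positive-time `v` carrying a clause-(i) floor, every `η > 0` and window `[1, Λ]`, some physical radius `δ > 0` such that for all
large `β`, tori `a(β)·L ≥ Λ₆` and `l ∈ [1, Λ]` the response profile at spacing `l·a(β)` has absolute mass `≤ η` on the sites
within physical distance `δ` of `tsupport v ∪ tsupport θv`. -/
def ContactSig : Prop :=
  ∀ (G : Type) [Group G] [TopologicalSpace G] [IsTopologicalGroup G] [CompactSpace G],
    IsCompactSimpleLieGroup G →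
    letI : MeasurableSpace G := borel G
    haveI : BorelSpace G := ⟨rfl⟩
    ∀ (r : LatticeRep G) (a : ℝ → ℝ) (v : SchwartzMap (EuclideanSpace ℝ (Fin 4)) ℝ),
      (∀ β, 0 < a β) → Filter.Tendsto a Filter.atTop (nhds 0) →
      tsupport v ⊆ {y : EuclideanSpace ℝ (Fin 4) | 0 < y 0} →
      (∃ ε β₅ Λ₅ : ℝ, 0 < ε ∧ ∀ β : ℝ, β₅ ≤ β → ∀ L : ℕ, Λ₅ ≤ a β * L →
        ε ≤ Q2 G r β L (a β) (thetaTest 4 v) v) →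
      ∀ η : ℝ, 0 < η → ∀ Λ : ℝ, 1 ≤ Λ → ∃ δ : ℝ, 0 < δ ∧ ∃ β₆ Λ₆ : ℝ, ∀ β : ℝ, β₆ ≤ β →
        ∀ L : ℕ, Λ₆ ≤ a β * L → ∀ l : ℝ, l ∈ Set.Icc 1 Λ →
          ∑ x ∈ box 4 L,
            (if Metric.infDist ((l * a β) • siteToE x) (tsupport v ∪ tsupport (thetaTest 4 v)) < δ then
              |respM G r β L (l * a β) v x| else 0) ≤ η

/-- **Statement of `stub_far`** (the FAR-FIELD CEILING, size L): likewise some physical radius `D > 0` beyond which the response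
profile has absolute mass `≤ η` (hyperscaling `|torusK3| ≲ dist⁻¹²` makes the tail summable in `d = 4`; needs a torus-uniform
third-cumulant ceiling, and — lead's caveat — `v` of time-bounded support, see the line card). -/
def FarSig : Prop :=
  ∀ (G : Type) [Group G] [TopologicalSpace G] [IsTopologicalGroup G] [CompactSpace G],
    IsCompactSimpleLieGroup G →
    letI : MeasurableSpace G := borel G
    haveI : BorelSpace G := ⟨rfl⟩
    ∀ (r : LatticeRep G) (a : ℝ → ℝ) (v : SchwartzMap (EuclideanSpace ℝ (Fin 4)) ℝ),
      (∀ β, 0 < a β) → Filter.Tendsto a Filter.atTop (nhds 0) →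
      tsupport v ⊆ {y : EuclideanSpace ℝ (Fin 4) | 0 < y 0} →
      (∃ ε β₅ Λ₅ : ℝ, 0 < ε ∧ ∀ β : ℝ, β₅ ≤ β → ∀ L : ℕ, Λ₅ ≤ a β * L →
        ε ≤ Q2 G r β L (a β) (thetaTest 4 v) v) →
      ∀ η : ℝ, 0 < η → ∀ Λ : ℝ, 1 ≤ Λ → ∃ D : ℝ, 0 < D ∧ ∃ β₆ Λ₆ : ℝ, ∀ β : ℝ, β₆ ≤ β →
        ∀ L : ℕ, Λ₆ ≤ a β * L → ∀ l : ℝ, l ∈ Set.Icc 1 Λ →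
          ∑ x ∈ box 4 L,
            (if D < ‖(l * a β) • siteToE x‖ then |respM G r β L (l * a β) v x| else 0) ≤ η

/-- **Statement of `stub_shell`** (Schwartz plateau function, smooth Urysohn, provable now, size M): for `0 < δ < D` a real
Schwartz `f` with values in `[0,1]`, equal to `1` on `{δ ≤ infDist(·, K)} ∩ {‖·‖ ≤ D}` and with `tsupport f` disjoint from
`K = tsupport v ∪ tsupport θv` (take a smooth bump of the compact set inside `{δ/2 < infDist(·,K)} ∩ {‖·‖ < 2D}`). -/
def ShellSig : Prop :=
  ∀ (v : SchwartzMap (EuclideanSpace ℝ (Fin 4)) ℝ) (δ D : ℝ), 0 < δ → δ < D →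
    ∃ f : SchwartzMap (EuclideanSpace ℝ (Fin 4)) ℝ,
      Disjoint (tsupport f) (tsupport v) ∧ Disjoint (tsupport f) (tsupport (thetaTest 4 v)) ∧
      (∀ y, f y ∈ Set.Icc (0 : ℝ) 1) ∧
      (∀ y, δ ≤ Metric.infDist y (tsupport v ∪ tsupport (thetaTest 4 v)) → ‖y‖ ≤ D → f y = 1)


/-! ## Route rev 3 (repaired crux, stmt-QuantumFields-24293): line «birth-r» (shrinking supports, relative tolerance)

The repaired `ResponseLocalisation` quantifies `∀ p ε η Λ ∃ ρ ∀ v ⊆ closedBall p ρ` (L¹-normalised, positive time, floor `ε`)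
with the RELATIVE tolerance `η·(1 + |∂_cQ2|)`.  `respM`, `SplitSig`, `ShellSig` are unchanged (and their stubs landed);
the two ceilings are re-cut (planner ym-idea-3 g2's BC3 skeleton `Cruxes/ResponseLocalisation/Lines/birth_r.lean`). -/

/-- **Statement of `stub_contact` of line «birth-r»** (CONTACT + INSIDE-SUPPORT CEILING; hardest, XL): for every base point
`p`, floor level `ε`, tolerance `η` and window `[1,Λ]` SOME support radius `ρ > 0` such that for every positive-time source
`v ⊆ closedBall p ρ`, `∫|v| ≤ 1`, carrying the floor, some physical radius `δ > 0` with: for all large `β`, tori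
`aβ·L ≥ Λ₆`, `l ∈ [1,Λ]`, the response profile has absolute mass `≤ η·(1 + |∂_cQ2|)` on the sites within physical distance
`δ` of `K = tsupport v ∪ tsupport θv` (this includes `K` itself: the inside-support share `≈ ḡ²(ρξ/l)` of the response is
what the `∃ ρ` buys — lead caveat R2). -/
def ContactSigR : Prop :=
  ∀ (G : Type) [Group G] [TopologicalSpace G] [IsTopologicalGroup G] [CompactSpace G], IsCompactSimpleLieGroup G → letI : MeasurableSpace G := borel G; haveI : BorelSpace G := ⟨rfl⟩; ∀ (r : LatticeRep G) (a : ℝ → ℝ), (∀ β, 0 < a β) → Filter.Tendsto a Filter.atTop (nhds 0) → ∀ (p : EuclideanSpace ℝ (Fin 4)) (ε : ℝ), 0 < ε → ∀ η : ℝ, 0 < η → ∀ Λ : ℝ, 1 ≤ Λ → ∃ ρ : ℝ, 0 < ρ ∧ ∀ v : SchwartzMap (EuclideanSpace ℝ (Fin 4)) ℝ, tsupport v ⊆ Metric.closedBall p ρ → tsupport v ⊆ {y : EuclideanSpace ℝ (Fin 4) | 0 < y 0} → (∫ y, |v y|) ≤ 1 → (∃ β₅ Λ₅ : ℝ, ∀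 β : ℝ, β₅ ≤ β → ∀ L : ℕ, Λ₅ ≤ a β * L → ε ≤ Q2 G r β L (a β) (thetaTest 4 v) v) → ∃ δ : ℝ, 0 < δ ∧ ∃ β₆ Λ₆ : ℝ, ∀ β : ℝ, β₆ ≤ β → ∀ L : ℕ, Λ₆ ≤ a β * L → ∀ l : ℝ, l ∈ Set.Icc 1 Λ → (∑ x ∈ box 4 L, (if Metric.infDist ((l * a β) • siteToE x) (tsupport v ∪ tsupport (thetaTest 4 v)) < δ then |respM G r β L (l * a β) v x| else 0)) ≤ η * (1 + |deriv (fun c : ℝ => Q2 G r c L (l * a β) (thetaTest 4 v) v) β|)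

/-- **Statement of `stub_far` of line «birth-r»** (FAR-FIELD CEILING, L): for every compactly supported
(`⊆ closedBall p ρ`) positive-time normalised source carrying the floor, every `η`, `Λ`: some `D > 0` beyond which the
response profile has absolute mass `≤ η·(1 + |∂_cQ2|)` (hyperscaling tail `D⁻⁸`; torus-uniform third-cumulant ceiling; no
wrap-around thanks to compact support — lead caveat R1). -/
def FarSigR : Prop :=
  ∀ (G : Type) [Group G] [TopologicalSpace G] [IsTopologicalGroup G] [CompactSpace G], IsCompactSimpleLieGroup G → letI : MeasurableSpace G := borel G; haveI : BorelSpace G := ⟨rfl⟩; ∀ (r : LatticeRep G) (a : ℝ → ℝ), (∀ β, 0 < a β) → Filter.Tendsto a Filter.atTop (nhds 0) → ∀ (p : EuclideanSpace ℝ (Fin 4)) (ρ ε : ℝ), 0 < ε → ∀ v : SchwartzMap (EuclideanSpace ℝ (Fin 4)) ℝ, tsupport v ⊆ Metric.closedBall p ρ → tsupport v ⊆ {y : EuclideanSpace ℝ (Fin 4) | 0 < y 0} → (∫ y, |v y|) ≤ 1 → (∃ β₅ Λ₅ : ℝ, ∀ β : ℝ, β₅ ≤ β → ∀ L : ℕ,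 Λ₅ ≤ a β * L → ε ≤ Q2 G r β L (a β) (thetaTest 4 v) v) → ∀ η : ℝ, 0 < η → ∀ Λ : ℝ, 1 ≤ Λ → ∃ D : ℝ, 0 < D ∧ ∃ β₆ Λ₆ : ℝ, ∀ β : ℝ, β₆ ≤ β → ∀ L : ℕ, Λ₆ ≤ a β * L → ∀ l : ℝ, l ∈ Set.Icc 1 Λ → (∑ x ∈ box 4 L, (if D < ‖(l * a β) • siteToE x‖ then |respM G r β L (l * a β) v x| else 0)) ≤ η * (1 + |deriv (fun c : ℝ => Q2 G r c L (l * a β) (thetaTest 4 v) v) β|)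


/-! ## Route rev 4/5 («RESTATE-FAR», 2026-08-28): the deciding crux is the CONTACT HALF (stmt-QuantumFields-24869);
line «collar-kernel» (lead ym-line-frs-p1 g2)

After the restate the crux `ResponseLocalisation` IS the collar bound (`ContactSigR` + `0 < p 0`, `respM` inlined) and the far
bound sits in the residual.  The lead's line «collar-kernel» cuts the crux into ONE kernel-level physics statement about the torus
third cumulant — no test functions — and a smearing/geometry reduction (provable now):

* `ContactKernelSigR` (PHYSICS, XL, the line's debt): for a PINNED unit map, pairs `(y,z)` at physical separation in a fixed
  window `[r₁, r₂]`, and any `κ > 0`, a physical radius `R > 0` such that the third insertion summed over the `R`-ball around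
  `z` has absolute mass `≤ κ·a(β)⁸` (hyperscaling normalisation) for all large `β`, uniformly on tori: the INTEGRATED CONTACT
  COEFFICIENT VANISHES WITH THE CUT — RG-improved one loop gives `≈ ḡ²(R)/2 · C₂(r)·a⁸/r⁸` (lead's instrument note and
  `Theorems/ForcedResponseSkewnessResponseLocalisationContactOneLoop.lean`, p598136: lattice contact `g₀²/2` + resummed shell
  `(ḡ²(R) − g₀²)/2`, tree-level shell coefficient ≡ 0 by `maxwellOddRing_eq_zero`); as a theorem it is the OPE factorisation
  `κ₃(x,y,z) ≈ C^A(x−z)·Cov(z,y)` with error control along the unit — Bałaban-class, not in print.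
* `CollarOfKernelSigR` (ANALYSIS, L, provable now): `ContactKernelSigR →` the crux body — Riemann sums `s⁴Σ|v(s·)| ≤ 2`
  (`riemann_abs_le_two`), support geometry of `closedBall p ρ` and its reflection (charged pairs at unit-`a` separation in
  `[p₀/Λ, 2‖p‖ + p₀]` for `ρ ≤ p₀/2`, no wrap-around on tori `aβ·L ≥ Λ₆`), collar ⊆ (R-ball around the `v`-insertion) ∪
  (R-ball around the `θv`-insertion) once `2ρ + δ < R` (`torusDist_le_norm_sub`), symmetry of `torusK3` in its last two slots,
  and the pinning witness obtained by a classical case split (if no admissible floor-carrying source exists in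
  `closedBall p (p₀/2)` the crux is vacuous; otherwise that source pins the unit).  Tolerance bookkeeping: `κ = η/16` gives collar
  mass `≤ 8κ/l⁸ ≤ η/2 ≤ η(1 + |∂_cQ2|)`. -/

/-- **Statement of `stub_contactKernel` of line «collar-kernel»** (PHYSICS, XL): near-insertion integrated ceiling for the torus
third cumulant of the action densities along a pinned unit — for pairs at physical separation `a(β)·d_T(y,z) ∈ [r₁, r₂]` and every
`κ > 0` some `R > 0` with `Σ_{x : a(β)·d_T(x,z) < R} |torusK3 β L x y z| ≤ κ·a(β)⁸` for `β ≥ β₀` and tori `a(β)·L ≥ Λ₀`. -/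
def ContactKernelSigR : Prop :=
  ∀ (G : Type) [Group G] [TopologicalSpace G] [IsTopologicalGroup G] [CompactSpace G],
    IsCompactSimpleLieGroup G →
    letI : MeasurableSpace G := borel G
    haveI : BorelSpace G := ⟨rfl⟩
    ∀ (r : LatticeRep G) (a : ℝ → ℝ), (∀ β, 0 < a β) → Filter.Tendsto a Filter.atTop (nhds 0) →
      (∃ (v₀ : SchwartzMap (EuclideanSpace ℝ (Fin 4)) ℝ) (ε β₅ Λ₅ : ℝ), HasCompactSupport v₀ ∧
        tsupport v₀ ⊆ {y : EuclideanSpace ℝ (Fin 4) | 0 < y 0} ∧ 0 < ε ∧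
        ∀ β : ℝ, β₅ ≤ β → ∀ L : ℕ, Λ₅ ≤ a β * L → ε ≤ Q2 G r β L (a β) (thetaTest 4 v₀) v₀) →
      ∀ r₁ r₂ : ℝ, 0 < r₁ → r₁ ≤ r₂ → ∀ κ : ℝ, 0 < κ →
        ∃ R : ℝ, 0 < R ∧ ∃ β₀ Λ₀ : ℝ, ∀ β : ℝ, β₀ ≤ β → ∀ L : ℕ, Λ₀ ≤ a β * L →
          ∀ y ∈ box 4 L, ∀ z ∈ box 4 L,
            r₁ ≤ a β * Summit.QuantumFields.YangMills.Cruxes.RunningCouplingCeiling.Pointwise.torusDist L y z →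
            a β * Summit.QuantumFields.YangMills.Cruxes.RunningCouplingCeiling.Pointwise.torusDist L y z ≤ r₂ →
              (∑ x ∈ box 4 L,
                (if a β * Summit.QuantumFields.YangMills.Cruxes.RunningCouplingCeiling.Pointwise.torusDist L x z < R then
                  |torusK3 G r β L x y z| else 0)) ≤ κ * (a β) ^ 8

/-- **Statement of `stub_collarOfKernel` of line «collar-kernel»** (ANALYSIS, L, provable now): the kernel-level near-insertion
ceiling implies the rev-4/5 crux `ResponseLocalisation` (its body verbatim: the collar bound with `0 < p 0`). -/
def CollarOfKernelSigR : Prop :=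
  ContactKernelSigR →
  ∀ (G : Type) [Group G] [TopologicalSpace G] [IsTopologicalGroup G] [CompactSpace G], IsCompactSimpleLieGroup G → letI : MeasurableSpace G := borel G; haveI : BorelSpace G := ⟨rfl⟩; ∀ (r : LatticeRep G) (a : ℝ → ℝ), (∀ β, 0 < a β) → Filter.Tendsto a Filter.atTop (nhds 0) → ∀ (p : EuclideanSpace ℝ (Fin 4)), 0 < p 0 → ∀ (ε : ℝ), 0 < ε → ∀ η : ℝ, 0 < η → ∀ Λ : ℝ, 1 ≤ Λ → ∃ ρ : ℝ, 0 < ρ ∧ ∀ v : SchwartzMap (EuclideanSpace ℝ (Fin 4)) ℝ, tsupport v ⊆ Metric.closedBall p ρ → tsupport v ⊆ {y : EuclideanSpace ℝ (Fin 4) | 0 < y 0} → (∫ y, |v y|) ≤ 1 → (∃ β₅ Λ₅ : ℝ, ∀ β : ℝ, β₅ ≤ β → ∀ L : ℕ, Λ₅ ≤ a β * L → ε ≤ Q2 G r β L (a β) (thetaTest 4 v) v) → ∃ δ : ℝ, 0 < δ ∧ ∃ β₆ Λ₆ : ℝ, ∀ β : ℝ, β₆ ≤ β → ∀ L : ℕ,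 Λ₆ ≤ a β * L → ∀ l : ℝ, l ∈ Set.Icc 1 Λ → (∑ x ∈ box 4 L, (if Metric.infDist ((l * a β) • siteToE x) (tsupport v ∪ tsupport (thetaTest 4 v)) < δ then |∑ y ∈ box 4 L, ∑ z ∈ box 4 L, (thetaTest 4 v) ((l * a β) • siteToE y) * v ((l * a β) • siteToE z) * torusK3 G r β L x y z| else 0)) ≤ η * (1 + |deriv (fun c : ℝ => Q2 G r c L (l * a β) (thetaTest 4 v) v) β|)


/-! ## Route rev 5, line «collar-kernel» RESHAPED to «femto-collar» (lead ym-line-frs-p1 g3, 2026-08-28): the physics debt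
in the spine's FEMTO currency

The kernel-level stub `ContactKernelSigR` (integrated near-insertion ceiling for the TORUS third cumulant, torus-uniform, with the
pair `(y,z)` at unit-scale separation) is itself a COLLAR TRANSFER of two femto-cube statements, exactly as the spine's
`MomentBounds ⇐ FBL` (`DlrCollarTransfer.stub_collar`, tree `abs_integral_prod_sub_mean_le`): one torus DLR step around `y` and one
around `z` turn `Σ_{x ∈ B_R(z)} |κ₃(x,y,z)|` into products of EXTERIOR-UNIFORM deviations of cube-kernel means — for `dens y` this
is the frozen-boundary law `FBL` (depth `D ≍ r₁/a(β)` ⇒ `C₁/D⁴ ≍ a(β)⁴`), for the near pair `(dens x, dens z)` it is the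
conditional covariance `kerCov_η(dens x, dens z)` whose exterior-dependence must carry a majorant `μ_β(x − z)/D⁴` SUMMABLE over
the `R`-ball with total `≤ κ` once the cut `R` is small (running coupling at scale `R`: `Σ μ ≍ ḡ²(R)`).  No torus, no volume,
no correlation at the unit scale is left in the physics statements; torus-uniformity is DERIVED.

* `NearCovLaw G r a` — the NEW femto clause (all exteriors `η`, femto cubes `b·a(β) ≤ ℓ₂`): reference values `n_β(w)` and a
  non-negative majorant `μ_β(w)` with `Σ_{w ∈ B} μ_β(w) ≤ κ` for every finite `B` inside the physical `R`-ball, and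
  `|kerCov_η(dens (z+w), dens z) − n_β(w)| ≤ μ_β(w)/depth(z)⁴` whenever the pair sits in the inner half (`2‖w‖ + 2 ≤ depth`).
* `FBLPinnedSigR` — the spine's `FBL G r a` VERBATIM, asked along a pinned unit (E0′/femto class; shared with the record's
  femto package `FBL ∧ FC2 ∧ FC3` of `OSLegsFromFemtoAndGap`).
* `NearCovLawSigR` — `NearCovLaw G r a` along a pinned unit (asymptotic-freedom class: the boundary sensitivity of the near-pair
  conditional covariance runs to zero with the cut; RG-improved one loop `μ_β(w) ≍ b₀ḡ⁴(|w|a)/|w|⁴`, lattice-contact terms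
  `≍ g₀²(β)`-relative at `|w| = O(1)`; Bałaban small-field RG in a femto cube with arbitrary exterior — not in print).
The analysis `FBLPinnedSigR → NearCovLawSigR → ContactKernelSigR` is the theorem `contactKernel_of_femto`
(`Theorems/ForcedResponseSkewnessResponseLocalisationContactOfFemto.lean`).  Nothing here is asserted. -/

section Femto

variable (G : Type) [Group G] [TopologicalSpace G] [IsTopologicalGroup G] [CompactSpace G]
  [MeasurableSpace G] [BorelSpace G] (r : LatticeRep G) (a : ℝ → ℝ)

/-- **Near-pair conditional-covariance law** (femto, all exteriors; the AF clause of line «femto-collar»): there is a femto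
scale `ℓ₂ > 0` such that for every `κ > 0` some physical cut `R > 0`, threshold `β₂`, reference values `n_β(w)` and a
non-negative majorant `μ_β(w)` with `Σ_{w ∈ B} μ_β(w) ≤ κ` for every finite set `B` of lattice vectors of physical length `< R`
satisfy: for `β ≥ β₂`, every cube `(c,b)` with `b·a(β) ≤ ℓ₂`, every exterior `η`, every `w` with `a(β)‖w‖ < R` and every
site `z` whose depth accommodates the pair (`2‖w‖ + 2 ≤ depth`), `|kerCov_η(dens (z+w), dens z) − n_β(w)| ≤ μ_β(w) / depth(c,b,z)⁴`.
(Physics: `μ_β(w) ≍ b₀ ḡ⁴(|w|·a(β))/|w|⁴` — the exterior modulates the near-pair covariance through a background field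
`B ≍ depth⁻²`, entering at second order, with the RUNNING coupling at the pair's scale; `Σ_{|w|<R/a} μ ≍ ḡ²(R) → 0` with the cut.) -/
def NearCovLaw : Prop :=
  ∃ ℓ₂ : ℝ, 0 < ℓ₂ ∧ ∀ κ : ℝ, 0 < κ → ∃ R : ℝ, 0 < R ∧ ∃ (β₂ : ℝ) (n μ : ℝ → (Fin 4 → ℤ) → ℝ),
    (∀ β w, 0 ≤ μ β w) ∧
    (∀ (β : ℝ) (B : Finset (Fin 4 → ℤ)), β₂ ≤ β → (∀ w ∈ B, a β * ‖siteToE w‖ < R) → ∑ w ∈ B, μ β w ≤ κ) ∧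
    ∀ β : ℝ, β₂ ≤ β → ∀ (c : Fin 4 → ℤ) (b : ℕ), (b : ℝ) * a β ≤ ℓ₂ →
      ∀ (η : LGConfig 4 G) (z w : Fin 4 → ℤ), a β * ‖siteToE w‖ < R → 2 * ‖siteToE w‖ + 2 ≤ (depth c b z : ℝ) →
        |kerCov G r β c b η (dens G r (z + w)) (dens G r z) - n β w| ≤ μ β w / (depth c b z : ℝ) ^ 4

end Femto

/-- **Statement of `stub_fblPinned` of line «femto-collar»** (E0′/FEMTO class, shared with the spine): the frozen-boundary femto
law `FBL G r a` of the record's femto package (`OSLegsFromFemtoAndGap`), VERBATIM, along a unit map pinned by a compactly supported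
positive-time clause-(i) floor witness. -/
def FBLPinnedSigR : Prop :=
  ∀ (G : Type) [Group G] [TopologicalSpace G] [IsTopologicalGroup G] [CompactSpace G],
    IsCompactSimpleLieGroup G →
    letI : MeasurableSpace G := borel G
    haveI : BorelSpace G := ⟨rfl⟩
    ∀ (r : LatticeRep G) (a : ℝ → ℝ), (∀ β, 0 < a β) → Filter.Tendsto a Filter.atTop (nhds 0) →
      (∃ (v₀ : SchwartzMap (EuclideanSpace ℝ (Fin 4)) ℝ) (ε β₅ Λ₅ : ℝ), HasCompactSupport v₀ ∧
        tsupport v₀ ⊆ {y : EuclideanSpace ℝ (Fin 4) | 0 < y 0} ∧ 0 < ε ∧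
        ∀ β : ℝ, β₅ ≤ β → ∀ L : ℕ, Λ₅ ≤ a β * L → ε ≤ Q2 G r β L (a β) (thetaTest 4 v₀) v₀) →
      FBL G r a

/-- **Statement of `stub_nearCovLaw` of line «femto-collar»** (ASYMPTOTIC-FREEDOM class, femto currency, the line's debt):
the near-pair conditional-covariance law `NearCovLaw G r a` along a pinned unit. -/
def NearCovLawSigR : Prop :=
  ∀ (G : Type) [Group G] [TopologicalSpace G] [IsTopologicalGroup G] [CompactSpace G],
    IsCompactSimpleLieGroup G →
    letI : MeasurableSpace G := borel G
    haveI : BorelSpace G := ⟨rfl⟩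
    ∀ (r : LatticeRep G) (a : ℝ → ℝ), (∀ β, 0 < a β) → Filter.Tendsto a Filter.atTop (nhds 0) →
      (∃ (v₀ : SchwartzMap (EuclideanSpace ℝ (Fin 4)) ℝ) (ε β₅ Λ₅ : ℝ), HasCompactSupport v₀ ∧
        tsupport v₀ ⊆ {y : EuclideanSpace ℝ (Fin 4) | 0 < y 0} ∧ 0 < ε ∧
        ∀ β : ℝ, β₅ ≤ β → ∀ L : ℕ, Λ₅ ≤ a β * L → ε ≤ Q2 G r β L (a β) (thetaTest 4 v₀) v₀) →
      NearCovLaw G r a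


/-! ## ONE femto engine stub for the whole route (lead ym-line-frs-p1 g3, 2026-08-28): the plane-resolved boundary law

The spine's femto package is stated with the PLANE-RESOLVED frozen-boundary law `FBL6 G r a` (`Statement.stub_fcp6`:
`FBL6 ∧ FC2 ∧ FC3` along a pinned unit); the tree already proves `fbl_of_fbl6 : FBL6 G r a → FBL G r a` and
`stub_collar6 : FBL6 G r a → MomentBounds6 G r a`.  Asking `FBL6` along a pinned unit therefore serves BOTH cruxes of this route:
`FBLPinnedSigR` (line «femto-collar» on 24869) and `ScaleFreeLocalPinnedSigR` (≡ `MomentBounds6` in the pinned unit, line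
«pointwise-log-ceiling-r» on 24275) follow from it (`Theorems/ForcedResponseSkewnessFemtoOfFBL6.lean`).  Nothing here is asserted. -/

/-- **Statement of `stub_fbl6Pinned`** (E0′/FEMTO class; THE shared engine stub of route `ForcedResponseSkewness`, registered on both
cruxes 24869 and 24275): the spine's plane-resolved frozen-boundary femto law `FBL6 G r a`, VERBATIM, along a unit map pinned by a
compactly supported positive-time clause-(i) floor witness. -/
def FBL6PinnedSigR : Prop :=
  ∀ (G : Type) [Group G] [TopologicalSpace G] [IsTopologicalGroup G] [CompactSpace G],
    IsCompactSimpleLieGroup G →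
    letI : MeasurableSpace G := borel G
    haveI : BorelSpace G := ⟨rfl⟩
    ∀ (r : LatticeRep G) (a : ℝ → ℝ), (∀ β, 0 < a β) → Filter.Tendsto a Filter.atTop (nhds 0) →
      (∃ (v₀ : SchwartzMap (EuclideanSpace ℝ (Fin 4)) ℝ) (ε β₅ Λ₅ : ℝ), HasCompactSupport v₀ ∧
        tsupport v₀ ⊆ {y : EuclideanSpace ℝ (Fin 4) | 0 < y 0} ∧ 0 < ε ∧
        ∀ β : ℝ, β₅ ≤ β → ∀ L : ℕ, Λ₅ ≤ a β * L → ε ≤ Q2 G r β L (a β) (thetaTest 4 v₀) v₀) →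
      FBL6 G r a


/-! ## CORRECTION (lead ym-line-frs-p1 g3, 2026-08-28T06:45Z): `NearCovLaw` is believed FALSE as typed — line «femto-collar» is dead

Self-audit before any refuter: for an exterior `η` with flux `Φ` (admissible up to `Φ = O(1)` for compact `G` — this is `FBL`'s own mechanism,
background `B ≍ Φ/D²` at depth `D`, `C₁ ≍ Φ²_max`), the LINEAR fluctuation term `(g₀/N) tr(B f)` of the action density gives
`δ_η kerCov(dens (z+w), dens z) = (g₀²/N²)·B K(w) B + O(g₀⁴)` with `K` the free F–F propagator, `|K(w)| ≍ 1/|w|⁴`, sign-indefinite.  Any admissible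
majorant therefore has `Σ_{a|w|<R} μ_β(w) ≳ (g₀²/N²) Φ² · 2π²c · log(R/a(β))`, and in a pinned unit `g₀² log(1/a(β)) → 1/(2b₀)`: the sum is `O(Φ²)`,
for every cut `R` and every `β` — the clause `Σ μ ≤ κ` for EVERY `κ > 0` fails (only a scale-free version with a fixed `κ₀ = O(1)` is plausible, which
feeds `contactKernel_of_femto` nothing).  The SIGNED shell sums cancel (the angular average of `∂∂D` is `(δ/4)ΔD = 0` off the origin), so a signed,
ball-integrated near-response law would be plausible — but the crux and `ContactKernelSigR` carry the absolute value PER SITE, whose smallness in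
the vacuum is the duality cancellation `tr(K K K) = 0` of the free `F²F²F²` function (tree `maxwellOddRing_eq_zero`) plus running: a property of
the correlation with the DISTANT insertion, invisible to every exterior-uniform law about the near femto cube.  Consequences: `NearCovLaw`,
`NearCovLawSigR` stay as definitions only (never to be staffed); `FBLPinnedSigR` / `FBL6PinnedSigR` are fine (sup laws, no smallness demanded;
`FBL6PinnedSigR` is the registered E0′ stub of crux 24275); crux 24869 is back on line «collar-kernel» (`ContactKernelSigR`); the landed
reductions `contactKernel_of_femto`, `contactKernel_of_fbl6` are correct implications.  Record: `Cruxes/ResponseLocalisation/Lines/femto-collar-dead.md`. -/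

end Summit.QuantumFields.YangMills.Cruxes.ResponseLocalisation.Birth

end
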